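import Mathlib
import HarnessLib
import HarnessLib.Audit
import Summits.HodgeConjecture.Statement
import Literature.AlgebraicGeometry.HodgeTheory.GysinFormalism
import HarnessLib.Audit.Status.Attr

/-!
Route: AffinePartDecay

DORMANT since 2026-08-26T18:58:13Z (reconciler: no traction for 5 d (last activity item-evidence-added at 2026-08-21T18:13:52Z); parked, not closed — `ledger route dormant route-HodgeConjecture-AffinePartDecay --off` to reactivate) — unstaffed, not closed; items shared with open routes are served there. `ledger route dormant <id> --off` reactivates.

Thesis X (idea card oka-affine-part-decay-at-infinity): it suffices to prove the Hodge conjecture ON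
AFFINE COMPLEMENTS — for every smooth projective X/ℂ of dimension n, every Zariski-closed H ⊂ X
whose complement U = X∖H is affine, every p and every rational class c ∈ H^{2p}(X(ℂ);ℂ) of Hodge
type (p,p): c ∈ Alg^p(X) + Ker(H^{2p}(X(ℂ);ℂ) → H^{2p}(U(ℂ);ℂ)). Lean (Sketch.lean rc 0, decl
`AffineComplementPrinciple`): `∀ ⦃n⦄ ⦃X⦄, IsSmoothProjective n X → ∀ (H : Set X.left) (hH : IsClosed
H), IsAffineOpen ⟨Hᶜ, hH.isOpen_compl⟩ → ∀ p (c : complexBetti X (2*p)), IsRationalClass c →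
IsOfHodgeType n X (2*p) p p c → c ∈ algebraicClasses X p ⊔ LinearMap.ker (complexBetti.restrictCompl
X H (2*p)).hom` (constants of Literature.AlgebraicGeometry.{Motives,HodgeTheory} and Mathlib's
AlgebraicGeometry.IsAffineOpen). Reading: U is Stein, so by Grauert's Oka principle every
topological bundle E|_U carries a UNIQUE holomorphic structure 𝓔; X says that for a Hodge K-class 𝓔
is algebraic, i.e. has moderate growth at the divisor at infinity, i.e. (Mochizuki) carries a
hermitian metric with curvature bounded for the Poincaré metric ω_P of (X,H) — "Oka on the affine
part, Hodge at infinity". Typed decomposition by degree: below the middle X is weak Lefschetz for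
algebraic classes (crux WeakLefschetzAlgebraicClasses, rank 2), in the middle degree it is
AffineMiddleDegree (rank 3); Assembly := WeakLefschetzAlgebraicClasses → AffineMiddleDegree →
HodgeConjecture (induction on dimension: Bertini, hard Lefschetz above the middle, Thom–Gysin +
polarisable semisimplicity for the kernel part, HC(H)).

Rationale: WHY THIS LINE. Take H a smooth hyperplane section, U = X∖H affine, hence Stein. On U integrability
is free and RIGID: a topological bundle has exactly one holomorphic structure 𝓔 (Grauert1958), so
with Jannsen1990MixedMotives §5.8/Thm 7.9 (read pp.60,94,112-113) and GAGA, HC ⇔ "the Grauert bundle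
𝓔 of every Hodge K-class on U is algebraic" ⇔ (Mochizuki2009 prolongation of acceptable bundles +
easy converse) "𝓔 has a hermitian metric with ω_P-bounded curvature", ω_P the Poincaré metric of
(X,H). HC becomes a GROWTH-AT-INFINITY property of one canonical analytic object; the import is
gauge theory on complete finite-volume Kähler manifolds (Simpson1988, Zucker1979, Biquard1992,
Mochizuki2009; growth philosophy of Griffiths1972/CornalbaGriffiths1975), not deformation theory on
compact X. The tree has no rank ≥ 2 holomorphic bundles, curvature, analytic coherent sheaves or
topological Chern character (scope_caveats of Voisin2002_weilTorus_hodgeClassWithoutSubvarieties):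
the TYPED layer is the cohomological skeleton; the analytic engine is filed as informal items +
definition requests (two-layer plan, glue later).
RANKED CRUXES. #2 WeakLefschetzAlgebraicClasses (H ⊂ X smooth, dim n in n+1, affine complement, 2p ≤
n: a rational class of X that is algebraic on H is algebraic on X) — what "Hodge at infinity" buys
BELOW the middle degree (Ker(H^{2p}X → H^{2p}U) = 0 by Andreotti–Frankel; HC(H) gives the model on
H). It is the homological shadow of weak Lefschetz for Chow groups (PatelRavindra2014 Conj 1.1, read
pp.65-66: Conj 1.3 infinitesimal lifting proved, Conj 1.2 algebraization open) = THICK of card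
ample-adic-thickening-weak-lefschetz; that formal engine and this analytic one (extend 𝓔 across H ⇔
acceptable metric; inward extension is Hartogs–Siu1971, dim ≥ 3) want the SAME decl, shared on
purpose. It follows from HC and from standard conjecture B(X) (known for abelian X): its content is
non-abelian. #3 AffineMiddleDegree = X at 2p = dim X: Ker(restriction to U) = Gysin H^{n-2}(H) and
the difficulty is the vanishing-cycle part H^n_van, invisible to thickening methods — the regime of
the finite-energy → heat-flow → L²-prolongation engine (informal items FiniteEnergyRepresentative,
PoincareHeatFlow, L2Prolongation); abelian Weil classes live here. Assembly (rank 1): #2 → #3 →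
HodgeConjecture (induction on dim: Bertini, hard Lefschetz above the middle, Thom–Gysin +
Voisin2014_kerRestriction_subHodge/semisimplicity, HC(H)). Target AffineComplementPrinciple (rank 0)
= X in all degrees; supports TargetSuffices (X → HC) and SummitImpliesTarget (sanity).
KILL CRITERIA. ¬#2 or ¬#3 would refute HC itself; the informative kills hit the engine: (a) a rank-2
hermitian holomorphic bundle on Δ*×Δ with L²(Poincaré) curvature and no coherent extension kills
L2Prolongation (engine collapses to "acceptable"); (b) if an acceptable/finite-energy metric on 𝓔
can only come from prior algebraicity (no variational/flow access; Simpson's flow needs |ΛF| ∈ L^∞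
and stability), FiniteEnergyRepresentative ⇔ HC with no gain → close 'restates target'; (c) if the
weighted-∂̄ obstruction near H sees all of H^{p+1,p-1}(X) (the card's own risk), the middle-degree
engine reduces to normal functions (Voisin2003 barrier) → close.
CALIBRATION. p = 1 is Lefschetz (1,1) (Pic of the Stein U is H²(U,ℤ), algebraic Pic its Hodge part);
Weil-type abelian fourfolds (HC largely known there, Markman) calibrate #3; first open: Weil-type
sixfolds (#3), non-abelian fivefolds, p = 2 (#2).
NOT DECOMPOSED YET. The metric engine (weighted ∂̄ near H, heat flow, bubbling at infinity), a typed
rank-one sanity form of L2Prolongation, the negative arm (wild L² rank-2 bundles),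
Gysin/hard-Lefschetz glue (lemmas via --supports). Definitions requested: PoincareTypeMetric,
HermitianHolomorphicBundle, IsAcceptableBundle, topologicalChernCharacter, analytified algebraic
bundles.

Novelty: DELTA (vs prior art below): (a) Grauert UNIQUENESS of the holomorphic structure on the Stein part
turns the card's 'find a tame holomorphic structure in the K-class' into a growth property of ONE
canonical bundle, exposing that 'Oka patching' is not free and near-H decay is free only
topologically — the honest split is by DEGREE: (b) below the middle the line IS weak Lefschetz for
algebraic classes (named open conjecture; shared decl with card
ample-adic-thickening-weak-lefschetz: two engines, one statement), in the middle degree it is a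
finite-energy/heat-flow/prolongation problem on (X∖H, ω_P) where thickening methods see nothing; (c)
L²-prolongation across a divisor in the Poincaré metric in rank ≥ 2 (Biquard1992: dim 1, L^p p>1) is
the analytic crux with a one-page falsifier (rank 2 on Δ*×Δ). Expected grade new-combination (= card
audit); typed layer alone = known reformulation + one named conjecture. PRIOR ART FOUND (2026-08-15;
lit search crossref: 'Cornalba Griffiths analytic cycles vector bundles non-compact', 'Mochizuki
Kobayashi-Hitchin tame harmonic', 'Biquard prolongement courbure Lp', 'Siu Hartogs extension
coherent sheaves', 'weak Lefschetz Chow groups hyperplane section'; local hybrid 'acceptable bundle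
prolongation', 'weak Lefschetz algebraic cycles restriction'; lit galaxy x3: 0 rows, service queued;
card audit zbMATH/crossref: nothing joins Oka-on-affine-part to tame prolongation): Griffiths1972
doi:10.4310/jdg/1214430494 + CornalbaGriffiths1975 doi:10.1007/  [refs: 10.4310/jdg/1214430494, 10.1007/bf01389905, 10.1007/bf01351803, 10.2140/gt.2009.13.359, 10.1090/s0894-0347-1988-0944577-9, 10.1142/s0129167x92000199, 10.2307/1971221, 10.2307/1970759, 10.4310/hha.2014.v16.n2.a4, doi:10.4310/jdg/1214430494, doi:10.1007/bf01389905, doi:10.1007/bf01351803, doi:10.2140/gt.2009.13.359, doi:10.1090/s0894-0347-1988-0944577-9, doi:10.1142/s0129167x92000199, doi:10.2307/19]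

Barriers (technique_class: oka-principle, tame-prolongation, holomorphic-vector-bundles): technique_class: oka-principle, tame-prolongation, holomorphic-vector-bundles (secondary:
curvature-decay, weak-lefschetz, induction-on-dimension)
- Literature.Barriers.HodgeConjecture.Voisin2002_weilTorus_hodgeClassWithoutSubvarieties:
[holomorphic-vector-bundles, chern-classes-of-coherent-sheaves] evaded structurally — step one
removes a divisor H with AFFINE complement (exists only on projective X) and algebraicity is
produced by prolongation across H + GAGA on X; on a Weil-type torus there is no such H and the
Grauert bundle lives on nothing; the typed cruxes quantify over IsSmoothProjective only.
- Literature.Barriers.HodgeConjecture.Zucker1977_kaehlerTorus_noAnalyticCycles: same evasion (no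
ample/affine-complement divisor on a non-projective torus; nothing here uses harmonic forms on
compact X).
- Literature.Barriers.HodgeConjecture.Voisin2003_generalHypersurface_noIntegralClassInF:
[induction-on-dimension, normal-functions] the induction uses HC(H) only for the Gysin-kernel class
on ONE fixed smooth H (semisimple lift), never Jacobi inversion / normal functions over a pencil;
the card's live risk (weighted ∂̄-obstruction near H seeing all of H^{p+1,p-1}) is exactly 'collapse
onto this barrier' and is kill criterion (c) of the rationale, confined to crux #3.
- Literature.Barriers.HodgeConjecture.Clemens1983_griffithsGroup_infiniteRank: no
finiteness/representability of cycle groups is used; crux #2 is about homological classes (⊗ℚ), not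
Chow groups, so infinite rank of

History (route lifecycle, newest last):
- 2026-08-26T18:58:13Z · DORMANT — reconciler: no traction for 5 d (last activity item-evidence-added at 2026-08-21T18:13:52Z); parked, not closed — `ledger route dormant route-HodgeConjecture-Af (operator:999:3806236)

sub-problem: HodgeConjecture · status: dormant · opened planner-plancard-HodgeConjecture-HodgeConject-1096992f-0 2026-08-15T11:00:09Z · rev 3 · ledger route-HodgeConjecture-AffinePartDecay
GENERATED by the gate from the ledger (D-0016/17). Provers cite these decls: `theorem foo : Summit.HodgeConjecture.HodgeConjecture.Theses.AffinePartDecay.<Decl> := …` in Summits/HodgeConjecture/HodgeConjecture/Theorems/<Name>.lean.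
-/

namespace Summit.HodgeConjecture.HodgeConjecture.Theses.AffinePartDecay

open scoped BigOperators Topology Manifold Classical MeasureTheory ProbabilityTheory Matrix InnerProductSpace ComplexConjugate ContinuousMap
open Filter Set Function TopologicalSpace MeasureTheory

attribute [summit_statement] _root_.HodgeConjecture

/-- item stmt-HodgeConjecture-1967 · target · rank 0 · open · by planner
why it might fail: Equivalent to HC (HC ⇒ X verbatim; X ⇒ HC = TargetSuffices by induction on dim): fails iff HC fails; first open instances are middle-degree (Weil-type abelian sixfolds of general discriminant, X∖Θ; abelian fourfolds announced via Markman2025SecantWeil).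
sources: Jannsen1990MixedMotives, Grauert1958, Mochizuki2009, Deligne2000, Markman2025SecantWeil
[target] Thesis X = the Hodge conjecture on AFFINE COMPLEMENTS: for X smooth projective of dim n,
any Zariski-closed H with affine complement U = X∖H (Mathlib IsAffineOpen of the complementary
Opens), every rational (p,p)-class c on X lies in algebraicClasses X p ⊔ Ker(restriction to U(ℂ)).
Equivalent to HC by known bookkeeping (HC ⇒ X trivially; X ⇒ HC = item TargetSuffices), and to 'the
Grauert holomorphic bundle of every Hodge K-class on the Stein manifold U is algebraic /
ω_P-acceptable' (Grauert1958, Mochizuki2009, Jannsen1990MixedMotives §5.8) — the card's reading.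
Split by degree into cruxes WeakLefschetzAlgebraicClasses (2p < n) and AffineMiddleDegree (2p = n);
2p > n is hard Lefschetz. Sketch.lean rc 0 (2026-08-15). -/
@[route_item "route-HodgeConjecture-AffinePartDecay", crux]
def AffineComplementPrinciple : Prop :=
  ∀ ⦃n : ℕ⦄ ⦃X : Literature.AlgebraicGeometry.Motives.SchemeOver ℂ⦄, Literature.AlgebraicGeometry.Motives.IsSmoothProjective n X → ∀ (H : Set X.left) (hH : IsClosed H), AlgebraicGeometry.IsAffineOpen (⟨Hᶜ, hH.isOpen_compl⟩ : X.left.Opens) → ∀ (p : ℕ) (c : Literature.AlgebraicGeometry.HodgeTheory.complexBetti X (2 * p)), Literature.AlgebraicGeometry.HodgeTheory.IsRationalClass c → Literature.AlgebraicGeometry.HodgeTheory.IsOfHodgeType n X (2 * p) p p c → c ∈ Literature.AlgebraicGeometry.HodgeTheory.algebraicClasses X p ⊔ LinearMap.ker (Literature.AlgebraicGeometry.HodgeTheory.complexBetti.restrictCompl X H (2 * p)).hom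

/-- item stmt-HodgeConjecture-1968 · crux · rank 2 · open · by planner
why it might fail: Open for p≥2 (first: p=2, dim X=5): the inversion 'c∪[H]=i_*i^*c algebraic ⇒ c algebraic' has Lefschetz-standard-conjecture strength: B(X) ⇒ it, known only for p=1 and B(X)-varieties (abelian, Lieberman). No tool lifts cycles off H (PatelRavindra2014 Conj 1.2 open). False iff HC fails on Im i*.
sources: PatelRavindra2014, Grothendieck1969StandardConjectures, Lieberman1968, Kleiman1968AlgebraicCycles, Nori1993, VoisinHodgeII2003
[crux] Weak Lefschetz for ALGEBRAIC (homological) classes: i : H → X a closed immersion of smooth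
projective varieties, dim H = n, dim X = n+1, X∖i(H) affine, 2p ≤ n; a RATIONAL class c ∈
H^{2p}(X(ℂ);ℂ) whose pull-back i*c lies in algebraicClasses H p lies in algebraicClasses X p.
Implied by HC (restriction is injective for 2p ≤ n by Andreotti–Frankel and reflects Hodge type) and
by standard conjecture B(X) (inverse Lefschetz algebraic; so known for abelian X); p = 1 is
Lefschetz (1,1); first open case p = 2, n = 4. It is the homological shadow of the weak Lefschetz
conjecture for Chow groups (PatelRavindra2014 Conj 1.1: CH^p(X)_ℚ ≅ CH^p(H)_ℚ for p < dim H/2; their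
Conj 1.3 = infinitesimal lifting is a theorem, Conj 1.2 = algebraization is open) and the THICK
statement of card ample-adic-thickening-weak-lefschetz (shared decl intended). In THIS route it is
what 'Hodge at infinity' buys below the middle degree: an algebraic bundle model exists on H, and
the analytic engine must extend the Grauert bundle of U across H (⇔ ω_P-acceptable metric,
Mochizuki2009; inward extension is Hartogs–Siu1971 for dim ≥ 3). -/
@[route_item "route-HodgeConjecture-AffinePartDecay", crux]
def WeakLefschetzAlgebraicClasses : Prop :=
  ∀ ⦃n p : ℕ⦄ ⦃X H : Literature.AlgebraicGeometry.Motives.SchemeOver ℂ⦄ (i : H ⟶ X), Literature.AlgebraicGeometry.Motives.IsSmoothProjective (n + 1) X → Literature.AlgebraicGeometry.Motives.IsSmoothProjective n H → AlgebraicGeometry.IsClosedImmersion i.left → (∀ U : X.left.Opens, (U : Set X.left) = (Set.range i.left.base)ᶜ → AlgebraicGeometry.IsAffineOpen U) → 2 * p ≤ n → ∀ (c : Literature.AlgebraicGeometry.HodgeTheory.complexBetti X (2 * p)), Literature.AlgebraicGeometry.HodgeTheory.IsRationalClass c → Literature.AlgebraicGeometry.HodgeTheory.complexBetti.map i (2 *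 p) c ∈ Literature.AlgebraicGeometry.HodgeTheory.algebraicClasses H p → c ∈ Literature.AlgebraicGeometry.HodgeTheory.algebraicClasses X p

/-- item stmt-HodgeConjecture-1969 · crux · rank 3 · open · by planner
why it might fail: It is HC in the middle degree modulo classes supported on H: fails iff HC fails there (open from Weil-type abelian sixfolds of general discriminant on; fourfolds only announced, Markman2025SecantWeil). Engine risk: the weighted ∂̄-obstruction near H may see all of H^{m+1,m-1}(X) (normal functions).
sources: Simpson1988, Mochizuki2009, Zucker1979, Biquard1992, Markman2025SecantWeil, Ramadas2010Spin7Hodge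
[crux] The affine-complement principle in the MIDDLE degree: X smooth projective of dim 2m, H
Zariski-closed with affine complement U, c ∈ H^{2m}(X(ℂ);ℂ) rational of type (m,m) ⇒ c ∈
algebraicClasses X m ⊔ Ker(H^{2m}(X) → H^{2m}(U)). For H a smooth hyperplane section the kernel is
Gysin(H^{2m-2}(H)) and the assembly finishes with semisimplicity + HC(H); the live part is the
vanishing/primitive piece H^{2m}_van, where Weil classes of abelian 2m-folds and transcendental
lattices of hypersurfaces sit. Reading (card O2/O1): the Grauert bundle 𝓔 on the Stein U of a Hodge
K-class admits a finite-energy metric for the Poincaré metric ω_P (FiniteEnergyRepresentative), the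
heat flow improves it (PoincareHeatFlow, Simpson1988), finite-energy HYM bundles prolong
(L2Prolongation; acceptable ones do, Mochizuki2009), GAGA. This is the hardest item (it is HC in the
middle dimension seen from U); ranked 3 because #2 is where the line has an independent edge. -/
@[route_item "route-HodgeConjecture-AffinePartDecay", crux]
def AffineMiddleDegree : Prop :=
  ∀ ⦃m : ℕ⦄ ⦃X : Literature.AlgebraicGeometry.Motives.SchemeOver ℂ⦄, Literature.AlgebraicGeometry.Motives.IsSmoothProjective (2 * m) X → ∀ (H : Set X.left) (hH : IsClosed H), AlgebraicGeometry.IsAffineOpen (⟨Hᶜ, hH.isOpen_compl⟩ : X.left.Opens) → ∀ (c : Literature.AlgebraicGeometry.HodgeTheory.complexBetti X (2 * m)), Literature.AlgebraicGeometry.HodgeTheory.IsRationalClass c → Literature.AlgebraicGeometry.HodgeTheory.IsOfHodgeType (2 * m) X (2 * m) m m c → c ∈ Literature.AlgebraicGeometry.HodgeTheory.algebraicClasses X m ⊔ LinearMap.ker (Literature.AlgebraicGeometry.HodgeTheory.complexBetti.restrictCompl X H (2 * m)).hom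

-- item stmt-HodgeConjecture-2120 · crux · rank 4 · open · by planner — informal only, no Lean statement yet:
--   [crux] (card O2, weakened; UNTYPED until definitions PoincareTypeMetric, HermitianHolomorphicBundle,
--   topologicalChernCharacter land) X smooth projective of dim n = 2m, H ⊂ X a smooth hyperplane
--   section, U = X∖H with the Poincaré-type complete Kähler metric ω_P of (X,H) (finite volume), α ∈
--   H^{2m}(X,ℚ) a Hodge class. CLAIM: there are N ≥ 1 and a topological complex vector bundle E on U(ℂ)
--   with ch(E) = rk + N·α|_U + (restrictions of algebraic classes), whose UNIQUE holomorphic structure 𝓔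
--   (Grauert1958: U is Stein) admits a hermitian metric h that is Simpson-admissible: |ΛF_h|_h ∈ L^∞(U)
--   and |F_h

-- item stmt-HodgeConjecture-2121 · crux · rank 5 · open · by planner — informal only, no Lean statement yet:
--   [crux] (card O1; UNTYPED until PoincareTypeMetric / HermitianHolomorphicBundle / IsAcceptableBundle
--   land) M a compact complex manifold, D ⊂ M a smooth hypersurface, ω_P a Poincaré-type metric on M∖D,
--   (𝓔,h) a hermitian holomorphic vector bundle on M∖D that is Hermitian–Yang–Mills for ω_P with finite
--   energy ∫|F_h|²_{h,ω_P} ω_P^n < ∞ (variant: merely |ΛF_h| ∈ L^∞ and F_h ∈ L²). CLAIM: 𝓔 extends to a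
--   reflexive coherent analytic sheaf on M (equivalently: the sheaf of holomorphic sections of 𝓔 with
--   |s|_h of polynomial growth in 1/dist(·,D) is coherent). KNOWN: curvature bounded for ω_P
--   (acceptable)

/-- item stmt-HodgeConjecture-1970 · support · rank 9 · closed · proved by Summit.HodgeConjecture.HodgeConjecture.Theorems.affinePartDecay_targetSuffices_proof @ f5de5484f89b (prover) · by planner
sources: Jannsen1990MixedMotives, VoisinHodgeII2003, VoisinChowRings2014, Deligne2000
[support] Bookkeeping X → HC, by strong induction on dim X: p = 0 (algebraicClasses_zero); 2p > n by
hard Lefschetz (c = h^{2p-n} ∪ c', c' rational Hodge of codim n-p) and cup of algebraic classes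
(AlgebraicClassesCup); 2p ≤ n: choose a smooth hyperplane section H (Bertini; complement affine), X
gives c = a + g with a algebraic (re-choose a, g RATIONAL: algebraicClasses and the kernel are
ℂ-spans of rational classes, SupportedClassesRational), g rational Hodge in Ker(restr_U) = Gysin
i_*(H^{2p-2}(H)) (Thom isomorphism for the smooth divisor H); Voisin2014_kerRestriction_subHodge /
polarisable semisimplicity give β rational Hodge on H with i_*β = g; HC(H) (induction) makes β,
hence i_*β, algebraic. Named facts the prover will need as cites if absent: Thom–Gysin exactness for
complexBetti, hard Lefschetz for complexBetti with the hyperplane class, Bertini, Nonempty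
(HodgeModel n X) (HodgeModelExistence). Sources: Jannsen1990MixedMotives pp.60, 112-113;
VoisinHodgeII2003 (Gysin, Lefschetz); Deligne2000. -/
@[route_item "route-HodgeConjecture-AffinePartDecay"]
def TargetSuffices : Prop :=
  AffineComplementPrinciple → HodgeConjecture

-- `TargetSuffices` holds: proved by `Summit.HodgeConjecture.HodgeConjecture.Theorems.affinePartDecay_targetSuffices_proof` @ f5de5484f89b (its module imports this route file, so no `_holds` link can be stated here).

/-- item stmt-HodgeConjecture-1971 · support · rank 9 · closed · proved by Summit.HodgeConjecture.HodgeConjecture.Theorems.affinePartDecay_summitImpliesTarget_proof @ 2d5b277d3bb7 (prover) · by planner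
sources: Deligne2000
[support] Sanity: HC → X (algebraicClasses X p ≤ algebraicClasses X p ⊔ Ker): checks that the Lean
form of X (IsAffineOpen of the anonymous-constructor Opens, arbitrary closed H) is not accidentally
stronger than the summit. Provable now in a few lines. -/
@[route_item "route-HodgeConjecture-AffinePartDecay"]
def SummitImpliesTarget : Prop :=
  HodgeConjecture → AffineComplementPrinciple

-- `SummitImpliesTarget` holds: proved by `Summit.HodgeConjecture.HodgeConjecture.Theorems.affinePartDecay_summitImpliesTarget_proof` @ 2d5b277d3bb7 (its module imports this route file, so no `_holds` link can be stated here).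

-- item stmt-HodgeConjecture-2124 · support · rank 9 · open · by planner — informal only, no Lean statement yet:
--   [support] (known results to vendor as Literature facts; UNTYPED until HermitianHolomorphicBundle /
--   IsAcceptableBundle / analytified algebraic bundles land) The reformulation chain that reads
--   AffineComplementPrinciple as a growth statement. For X smooth projective, H a hyperplane section, U
--   = X∖H (affine ⇒ Stein): (i) Grauert1958 Oka principle: Vect_top(U(ℂ)) = Vect_hol(U^an) — every
--   topological bundle has a holomorphic structure, UNIQUE up to isomorphism; (ii) GAGA on U +
--   Jannsen1990MixedMotives §5.8: HC(X) for all X ⇔ for all (X,H) and every Hodge class α, the Grauert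
--   bundle 𝓔 of some E with

-- item stmt-HodgeConjecture-2125 · support · rank 9 · open · by planner — informal only, no Lean statement yet:
--   [support] (Simpson1988 Thm 1 + Prop on admissible metrics; UNTYPED until PoincareTypeMetric /
--   HermitianHolomorphicBundle land) On (U, ω_P), U = X∖H with a Poincaré-type metric (finite volume;
--   exhaustion function with bounded gradient and Laplacian — Simpson's assumptions 1–3 hold for such
--   metrics), let (𝓔, h₀) be a hermitian holomorphic bundle with |ΛF_{h₀}| ∈ L^∞. Then the
--   Hermitian–Yang–Mills heat flow exists for all time with h_t mutually bounded with h₀ on finite time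
--   intervals, and EITHER converges (subsequentially, modulo the usual codimension-2 bubbling, which on
--   non-compact U may escap

/-- item stmt-HodgeConjecture-1972 · assembly · rank 1 · closed · proved by Summit.HodgeConjecture.HodgeConjecture.Theorems.affinePartDecay_assembly_proof @ d28d5e79c737 (prover) · by planner
sources: VoisinHodgeII2003, Jannsen1990MixedMotives, VoisinChowRings2014
[assembly] WeakLefschetzAlgebraicClasses → AffineMiddleDegree → HodgeConjecture. Strong induction on
n = dim X; fix p and a rational (p,p)-class c. p = 0: algebraicClasses_zero. 2p > n: hard Lefschetz
writes c = h^{2p-n} ∪ c' with c' rational Hodge of codimension n-p < n/2 (same X), conclude by the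
case 2p < n and AlgebraicClassesCup. 2p = n: choose a smooth hyperplane section H (Bertini), apply
AffineMiddleDegree, lift the kernel part through Gysin by Thom isomorphism +
Voisin2014_kerRestriction_subHodge/semisimplicity to a rational Hodge class on H, use HC(H)
(induction) and that Gysin of algebraic is algebraic. 2p < n: choose a smooth hyperplane section i :
H → X (dim n-1 ≥ 2p), i*c is rational of type (p,p) on H (functoriality of
IsRationalClass/IsOfHodgeType), HC(H) by induction gives i*c ∈ algebraicClasses H p, and
WeakLefschetzAlgebraicClasses (with its n := n-1) gives c algebraic. n ≤ 1 needs no H. The Nonempty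
(HodgeModel n X) conjunct of HodgeConjectureFor comes from HodgeModelExistence. Glue lemmas
(Thom–Gysin exactness, hard Lefschetz for complexBetti, Bertini with affine complement) are attached
by provers with --supports Assembly or requested as cites. -/
@[route_item "route-HodgeConjecture-AffinePartDecay", crux]
def Assembly : Prop :=
  WeakLefschetzAlgebraicClasses → AffineMiddleDegree → HodgeConjecture

-- `Assembly` holds: proved by `Summit.HodgeConjecture.HodgeConjecture.Theorems.affinePartDecay_assembly_proof` @ d28d5e79c737 (its module imports this route file, so no `_holds` link can be stated here).

/-! D-0027 §2.1 — DECIDING THEOREM (planner-authored via `route open/edit --closes-file`; by planner-rbadge-HodgeConjecture-AffinePartDecay-c4db6b6d-g2-0 2026-08-15T16:10:12Z):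
its hypotheses are this route's items and its conclusion the sub-problem Statement (glue_lint), and it elaborates with this file. -/

@[closes "route-HodgeConjecture-AffinePartDecay"] theorem closes (h1 : WeakLefschetzAlgebraicClasses) (h2 : AffineMiddleDegree) (h3 : Assembly) : _root_.HodgeConjecture := h3 h1 h2

end Summit.HodgeConjecture.HodgeConjecture.Theses.AffinePartDecay
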